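import Summits.Ventures.PercRepro.ProfilePointedCircuitClassesTwelveCaptureB

/-!
# PercRepro — THE LINE REGIME OF THE TWELVE-POINT STATEMENT: A POINT ON THE LINE OF A SERIES PAIR
(p5, gen 45; `proofs/P5-GM1.md` §67(d), ADDENDUM 2)

On `#E = 12`, `ρ(E) = 7`, let `{a, a'}` be a series pair and `e` a third point with `{a, a', e}` a three-point
line (`ρ{a, a', e} = 2`, the three pairs of rank `2`).  Then the capture inequality (C) of TwelveCaptureB holds
with room, so `in_5(e) ≤ out_6(e)`: every demand through `a` contains `e`, hence captures `a' ∈ cl{a, e}`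
(`δ = d_a`); a unit through `a` avoiding `a'` captures `a'` iff it captures `e`; and the units through `a` that
capture NEITHER inject into the units containing both `a, a'` by `S ↦ (E ∖ S) − e + a`
(`card_filter_free_le_card_filter_both_of_line`), so `u₂ + y ≥ u_a ≥ d_a = δ`.  In the eleven-point minor
`N ／ a` this is the case `a' ∥ e`, where (C) coincides with the `n = 10` theorem (§67(d)).
-/

open scoped Matroid

namespace PercRepro.Cogirth

open Finset ThmH Skew Shadow Profile

variable {α : Type} [DecidableEq α] {N : Matroid α} [N.Finite]

section TwelveCaptureD

/-- On a three-point line `{a, a', e}` (all three pairs of rank `2`), `a' ∈ cl{a, e}`. -/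
theorem mem_clF_of_line_triple {a a' e : α} (ha : a ∈ gr N) (ha' : a' ∈ gr N) (he : e ∈ gr N)
    (hae : rk N {a, e} = 2) (htri : rk N {a, a', e} = 2) : a' ∈ clF N {a, e} := by
  rw [mem_clF_iff_rk_insert_eq ha' (insert_subset ha (singleton_subset_iff.2 he))]
  have h1 : insert a' ({a, e} : Finset α) = {a, a', e} := by
    ext x
    simp only [mem_insert, mem_singleton]
    tauto
  rw [h1, htri, hae]

/-- A point of `cl{p, q}` with `p, q ∈ cl X` lies in `cl X`. -/
theorem mem_clF_of_mem_clF_pair_capture {p q x : α} {X : Finset α} (hX : X ⊆ gr N) (hp : p ∈ clF N X)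
    (hq : q ∈ clF N X) (hx : x ∈ clF N {p, q}) : x ∈ clF N X := by
  have h1 : ({p, q} : Finset α) ⊆ clF N X := insert_subset hp (singleton_subset_iff.2 hq)
  have h2 := clF_mono (M := N) h1 hx
  exact clF_clF_subset_self X hX h2

/-- **EVERY DEMAND THROUGH `a` IS CAPTURED** on a line `{a, a', e}`: for `W ∈ BI_5` with `e, a ∈ W`,
`ρ(W + a') = 5` (as `a' ∈ cl{a, e} ⊆ cl W`); so `δ = d_a`. -/
theorem card_filter_captured_eq_of_line (hn : (gr N).card = 12) (hR : rk N (gr N) = 7) {a a' e : α}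
    (h : SeriesPair N a a') (he : e ∈ gr N) (hae : rk N {a, e} = 2) (htri : rk N {a, a', e} = 2) :
    ((biIndepSets N 5).filter (fun W => (e ∈ W ∧ a ∈ W) ∧ rk N (insert a' W) = 5)).card =
      ((biIndepSets N 5).filter (fun W => (e ∈ W ∧ a ∈ W) ∧ a' ∉ W)).card := by
  have ha : a ∈ gr N := h.1
  have ha' : a' ∈ gr N := h.2.1
  have hn5 : (gr N).card = rk N (gr N) + 5 := by omega
  apply congrArg Finset.card
  apply filter_congr
  intro W hW
  have hWg : W ⊆ gr N := (mem_biIndepSets.1 hW).1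
  have hWr : rk N W = 5 := by rw [(mem_biIndepSets.1 hW).2.2.1, (mem_biIndepSets.1 hW).2.1]
  constructor
  · rintro ⟨⟨heW, haW⟩, _⟩
    exact ⟨⟨heW, haW⟩, not_mem_of_mem_biIndepSets_of_seriesPair h hn5 hW haW⟩
  · rintro ⟨⟨heW, haW⟩, _⟩
    refine ⟨⟨heW, haW⟩, ?_⟩
    have hsub : ({a, e} : Finset α) ⊆ W := insert_subset haW (singleton_subset_iff.2 heW)
    have hcl : a' ∈ clF N W := clF_mono (M := N) hsub (mem_clF_of_line_triple ha ha' he hae htri)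
    rw [(mem_clF_iff_rk_insert_eq ha' hWg).1 hcl, hWr]

/-- `E ∖ ((E ∖ S) − e + a) = (S − a) + e` for `S ⊆ E`, `e ∈ E ∖ S`, `a ∈ S`. -/
theorem sdiff_insert_sdiff_erase_eq {S : Finset α} (hSg : S ⊆ gr N) {a e : α} (he : e ∈ gr N) (heS : e ∉ S)
    (haS : a ∈ S) : gr N \ insert a ((gr N \ S).erase e) = insert e (S.erase a) := by
  ext y
  constructor
  · intro hy
    rw [mem_sdiff, mem_insert, mem_erase, mem_sdiff] at hy
    obtain ⟨hyg, hy⟩ := hy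
    rw [mem_insert, mem_erase]
    by_cases hye : y = e
    · exact Or.inl hye
    · right
      refine ⟨fun hya => hy (Or.inl hya), ?_⟩
      by_contra hyS
      exact hy (Or.inr ⟨hye, hyg, hyS⟩)
  · intro hy
    rw [mem_insert, mem_erase] at hy
    rw [mem_sdiff, mem_insert, mem_erase, mem_sdiff]
    rcases hy with rfl | ⟨hya, hyS⟩
    · exact ⟨he, fun h' => h'.elim (fun h'' => heS (h'' ▸ haS)) (fun h'' => h''.1 rfl)⟩
    · exact ⟨hSg hyS, fun h' => h'.elim hya (fun h'' => h''.2.2 hyS)⟩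

/-- **THE FREE UNITS INJECT INTO THE UNITS CONTAINING BOTH `a, a'`** on a line `{a, a', e}`: a unit `S ∋ a`, `∌ a'`
with `ρ(S + a') = 7` is sent to `(E ∖ S) − e + a`, a unit containing `a, a'` (its complement `(S − a) + e` is
independent because `e ∈ cl(S − a)` would give `a' ∈ cl{a, e} ⊆ cl S`; its rank is `6` because `a ∈ cl((E ∖ S) − e)`
together with `a' ∈ E ∖ S` would put `e ∈ cl{a, a'}` into `cl((E ∖ S) − e)`, contradicting the independence of
`E ∖ S`). -/
theorem card_filter_free_le_card_filter_both_of_line (hn : (gr N).card = 12) {a a' e : α} (h : SeriesPair N a a')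
    (he : e ∈ gr N) (hea : e ≠ a) (hea' : e ≠ a') (hae : rk N {a, e} = 2) (ha'a : rk N {a', a} = 2)
    (htri : rk N {a, a', e} = 2) :
    ((biIndepSets N 6).filter (fun S => ((e ∉ S ∧ a ∈ S) ∧ a' ∉ S) ∧ rk N (insert a' S) = 7)).card ≤
      ((biIndepSets N 6).filter (fun S => (e ∉ S ∧ a ∈ S) ∧ a' ∈ S)).card := by
  have ha : a ∈ gr N := h.1
  have ha' : a' ∈ gr N := h.2.1
  have hne : a ≠ a' := h.2.2.1
  have ha'cl : a' ∈ clF N {a, e} := mem_clF_of_line_triple ha ha' he hae htri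
  have hecl : e ∈ clF N {a', a} := by
    have htri' : rk N {a', e, a} = 2 := by
      have : ({a', e, a} : Finset α) = {a, a', e} := by
        ext x
        simp only [mem_insert, mem_singleton]
        tauto
      rw [this, htri]
    exact mem_clF_of_line_triple ha' he ha ha'a htri'
  apply card_le_card_of_injOn (fun S => insert a ((gr N \ S).erase e))
  · intro S hS
    rw [mem_coe, mem_filter] at hS
    obtain ⟨hSb, ⟨⟨heS, haS⟩, ha'S⟩, hrk⟩ := hS
    obtain ⟨hSg, hSc, hSr, hScompl⟩ := mem_biIndepSets.1 hSb
    have hec : e ∈ gr N \ S := mem_sdiff.2 ⟨he, heS⟩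
    have ha'c : a' ∈ gr N \ S := mem_sdiff.2 ⟨ha', ha'S⟩
    have hccard : (gr N \ S).card = 6 := by rw [card_sdiff_of_subset hSg, hn, hSc]
    have hcrk : rk N (gr N \ S) = 6 := by rw [hScompl, hccard]
    -- K := (E ∖ S) − e
    have hKsub : (gr N \ S).erase e ⊆ gr N := (erase_subset _ _).trans sdiff_subset
    have hKcard : ((gr N \ S).erase e).card = 5 := by rw [card_erase_of_mem hec, hccard]
    have hKrk : rk N ((gr N \ S).erase e) = 5 := by
      rw [← hKcard]
      exact rk_eq_card_of_subset_of_rk_eq_card (erase_subset _ _) hScompl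
    have haK : a ∉ (gr N \ S).erase e := fun h' => (mem_sdiff.1 (mem_of_mem_erase h')).2 haS
    have ha'K : a' ∈ (gr N \ S).erase e := mem_erase.2 ⟨hea'.symm, ha'c⟩
    -- rank of S' = insert a K is 6: else e ∈ cl{a', a} ⊆ cl(insert a K), contradicting rk(E ∖ S) = 6
    have hS'rk : rk N (insert a ((gr N \ S).erase e)) = 6 := by
      have hle : rk N (insert a ((gr N \ S).erase e)) ≤ 6 := by
        have := rk_insert_le_add_one ha hKsub
        omega
      have hge : 6 ≤ rk N (insert a ((gr N \ S).erase e)) := by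
        by_contra hlt
        have heq : rk N (insert a ((gr N \ S).erase e)) = rk N ((gr N \ S).erase e) := by
          have := rk_mono' (M := N) (subset_insert a ((gr N \ S).erase e))
          omega
        have hacl : a ∈ clF N ((gr N \ S).erase e) := (mem_clF_iff_rk_insert_eq ha hKsub).2 heq
        have ha'cl' : a' ∈ clF N ((gr N \ S).erase e) := subset_clF_self_of_subset_gr hKsub ha'K
        have hecl' : e ∈ clF N ((gr N \ S).erase e) := mem_clF_of_mem_clF_pair_capture hKsub ha'cl' hacl hecl
        have h2 := (mem_clF_iff_rk_insert_eq he hKsub).1 hecl'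
        rw [insert_erase hec, hcrk, hKrk] at h2
        omega
      omega
    -- the complement (S − a) + e is independent: else e ∈ cl(S − a) ⊆ cl S and a' ∈ cl{a, e} ⊆ cl S
    have hcompl : gr N \ insert a ((gr N \ S).erase e) = insert e (S.erase a) :=
      sdiff_insert_sdiff_erase_eq hSg he heS haS
    have hSa : S.erase a ⊆ gr N := (erase_subset _ _).trans hSg
    have hSacard : (S.erase a).card = 5 := by rw [card_erase_of_mem haS, hSc]
    have hSark : rk N (S.erase a) = 5 := by
      rw [← hSacard]
      exact rk_eq_card_of_subset_of_rk_eq_card (erase_subset _ _) hSr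
    have heSa : e ∉ S.erase a := fun h' => heS (mem_of_mem_erase h')
    have hc'rk : rk N (insert e (S.erase a)) = 6 := by
      have hle : rk N (insert e (S.erase a)) ≤ 6 := by
        have := rk_insert_le_add_one he hSa
        omega
      have hge : 6 ≤ rk N (insert e (S.erase a)) := by
        by_contra hlt
        have heq : rk N (insert e (S.erase a)) = rk N (S.erase a) := by
          have := rk_mono' (M := N) (subset_insert e (S.erase a))
          omega
        have hecl' : e ∈ clF N (S.erase a) := (mem_clF_iff_rk_insert_eq he hSa).2 heq
        have hecl'' : e ∈ clF N S := clF_mono (M := N) (erase_subset a S) hecl'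
        have hacl : a ∈ clF N S := subset_clF_self_of_subset_gr hSg haS
        have ha'cl'' : a' ∈ clF N S := mem_clF_of_mem_clF_pair_capture hSg hacl hecl'' ha'cl
        have h2 := (mem_clF_iff_rk_insert_eq ha' hSg).1 ha'cl''
        rw [hrk, hSr, hSc] at h2
        omega
      omega
    rw [mem_coe, mem_filter, mem_biIndepSets]
    refine ⟨⟨insert_subset ha hKsub, ?_, ?_, ?_⟩, ⟨?_, mem_insert_self _ _⟩, mem_insert_of_mem ha'K⟩
    · rw [card_insert_of_notMem haK, hKcard]
    · rw [hS'rk, card_insert_of_notMem haK, hKcard]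
    · rw [hcompl, hc'rk, card_insert_of_notMem heSa, hSacard]
    · intro h'
      rcases mem_insert.1 h' with h'' | h''
      · exact hea h''
      · exact (mem_erase.1 h'').1 rfl
  · intro S₁ hS₁ S₂ hS₂ heq
    rw [mem_coe, mem_filter] at hS₁ hS₂
    have h₁ : S₁ ⊆ gr N := (mem_biIndepSets.1 hS₁.1).1
    have h₂ : S₂ ⊆ gr N := (mem_biIndepSets.1 hS₂.1).1
    have ha₁ : a ∉ (gr N \ S₁).erase e := fun h' => (mem_sdiff.1 (mem_of_mem_erase h')).2 hS₁.2.1.1.2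
    have ha₂ : a ∉ (gr N \ S₂).erase e := fun h' => (mem_sdiff.1 (mem_of_mem_erase h')).2 hS₂.2.1.1.2
    have he₁ : e ∈ gr N \ S₁ := mem_sdiff.2 ⟨he, hS₁.2.1.1.1⟩
    have he₂ : e ∈ gr N \ S₂ := mem_sdiff.2 ⟨he, hS₂.2.1.1.1⟩
    have heq' : insert a ((gr N \ S₁).erase e) = insert a ((gr N \ S₂).erase e) := heq
    have h3 : (gr N \ S₁).erase e = (gr N \ S₂).erase e := by
      rw [← erase_insert ha₁, ← erase_insert ha₂, heq']
    have h4 : gr N \ S₁ = gr N \ S₂ := by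
      rw [← insert_erase he₁, ← insert_erase he₂, h3]
    rw [← Finset.sdiff_sdiff_eq_self h₁, ← Finset.sdiff_sdiff_eq_self h₂, h4]

/-- **THE LINE REGIME**: on `#E = 12`, `ρ(E) = 7`, if `{a, a'}` is a series pair and `{a, a', e}` is a three-point
line (the three pairs of rank `2`, the triple of rank `2`), then `in_5(e) ≤ out_6(e)`: the capture inequality holds
(`δ = d_a ≤ u_a = y + u_a^{free} ≤ y + u₂`), and the capture reduction closes. -/
theorem inCount_five_le_outCount_six_of_line (hn : (gr N).card = 12) (hR : rk N (gr N) = 7) {a a' e : α}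
    (h : SeriesPair N a a') (he : e ∈ gr N) (hea : e ≠ a) (hea' : e ≠ a') (hae : rk N {a, e} = 2)
    (ha'a : rk N {a', a} = 2) (htri : rk N {a, a', e} = 2) : inCount N 5 e ≤ outCount N 6 e := by
  have ha : a ∈ gr N := h.1
  have ha' : a' ∈ gr N := h.2.1
  have hne : a ≠ a' := h.2.2.1
  apply inCount_five_le_outCount_six_of_seriesPair_of_capture hn hR h he hea hea'
  rw [card_filter_captured_eq_of_line hn hR h he hae htri]
  -- `d_a ≤ u_a` (the `n = 10` theorem), `u_a = y + u_a^{free}`, `u_a^{free} ≤ u₂`, `y + u₂ ≤ #{capturing units}`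
  have hIa : ∀ W : Finset α, e ∉ insert a W ↔ e ∉ W := by
    intro W
    rw [mem_insert, not_or]
    exact ⟨fun h' => h'.2, fun h' => ⟨hea, h'⟩⟩
  have hIa' : ∀ W : Finset α, e ∈ insert a' W ↔ e ∈ W := by
    intro W
    rw [mem_insert]
    exact ⟨fun h' => h'.resolve_left hea', fun h' => Or.inr h'⟩
  have hPe : ∀ W : Finset α, e ∈ insert a' (W.erase a) ↔ e ∈ W := by
    intro W
    rw [mem_insert, mem_erase]
    constructor
    · rintro (h' | ⟨_, h'⟩)
      · exact absurd h' hea'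
      · exact h'
    · intro h'
      exact Or.inr ⟨hea, h'⟩
  have hPe' : ∀ W : Finset α, e ∈ insert a (W.erase a') ↔ e ∈ W := by
    intro W
    rw [mem_insert, mem_erase]
    constructor
    · rintro (h' | ⟨_, h'⟩)
      · exact absurd h' hea
      · exact h'
    · intro h'
      exact Or.inr ⟨hea', h'⟩
  have hN₁n := card_gr_minor_add_two_of_seriesPair h
  have hN₁r := rk_gr_minor_add_one_of_seriesPair h
  have he₁ : e ∈ gr ((N ／ ({a} : Set α)) ＼ ({a'} : Set α)) := by
    rw [gr_minor_of_seriesPair]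
    exact mem_erase.2 ⟨hea', mem_erase.2 ⟨hea, he⟩⟩
  have h10 := inOutBottomFour_holds (α := α) ((N ／ ({a} : Set α)) ＼ ({a'} : Set α)) e he₁ (by omega) (by omega)
  unfold inCount outCount at h10
  rw [card_filter_minor_insert_right_eq_of_seriesPair h 4 (fun Y => e ∈ Y) hIa',
    card_filter_minor_insert_left_eq_of_seriesPair h 5 (fun Y => e ∉ Y) hIa] at h10
  simp only [Nat.reduceAdd] at h10
  have hD1 := card_filter_swap_of_seriesPair h 5 (fun W => e ∈ W) hPe hPe'
  -- split `u_a` by `ρ(S + a') = 7`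
  have hUa := card_filter_add_card_filter_not
    (s := (biIndepSets N 6).filter (fun S => (e ∉ S ∧ a ∈ S) ∧ a' ∉ S)) (fun S => rk N (insert a' S) = 7)
  simp only [filter_filter] at hUa
  have hfree := card_filter_free_le_card_filter_both_of_line hn h he hea hea' hae ha'a htri
  -- the capturing units: `y + u₂`
  have hUc : ((biIndepSets N 6).filter
      (fun S => ((e ∉ S ∧ a ∈ S) ∧ a' ∉ S) ∧ ¬ rk N (insert a' S) = 7)).card +
      ((biIndepSets N 6).filter (fun S => (e ∉ S ∧ a ∈ S) ∧ a' ∈ S)).card =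
      ((biIndepSets N 6).filter (fun S => (e ∉ S ∧ a ∈ S) ∧ rk N (insert a' S) = 6)).card := by
    have hsplit := card_filter_add_card_filter_not
      (s := (biIndepSets N 6).filter (fun S => (e ∉ S ∧ a ∈ S) ∧ rk N (insert a' S) = 6)) (fun S => a' ∈ S)
    simp only [filter_filter] at hsplit
    have e1 : ((biIndepSets N 6).filter
        (fun S => ((e ∉ S ∧ a ∈ S) ∧ rk N (insert a' S) = 6) ∧ a' ∈ S)).card =
        ((biIndepSets N 6).filter (fun S => (e ∉ S ∧ a ∈ S) ∧ a' ∈ S)).card := by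
      apply congrArg Finset.card
      apply filter_congr
      intro S hS
      constructor
      · rintro ⟨⟨hp, _⟩, ha'S⟩
        exact ⟨hp, ha'S⟩
      · rintro ⟨hp, ha'S⟩
        refine ⟨⟨hp, ?_⟩, ha'S⟩
        rw [insert_eq_of_mem ha'S, (mem_biIndepSets.1 hS).2.2.1, (mem_biIndepSets.1 hS).2.1]
    have e2 : ((biIndepSets N 6).filter
        (fun S => ((e ∉ S ∧ a ∈ S) ∧ rk N (insert a' S) = 6) ∧ ¬ a' ∈ S)).card =
        ((biIndepSets N 6).filter
          (fun S => ((e ∉ S ∧ a ∈ S) ∧ a' ∉ S) ∧ ¬ rk N (insert a' S) = 7)).card := by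
      apply congrArg Finset.card
      apply filter_congr
      intro S hS
      have hSg : S ⊆ gr N := (mem_biIndepSets.1 hS).1
      have h3 : rk N S = 6 := by rw [(mem_biIndepSets.1 hS).2.2.1, (mem_biIndepSets.1 hS).2.1]
      have h1 : rk N (insert a' S) ≤ rk N S + 1 := rk_insert_le_add_one ha' hSg
      have h2 : rk N S ≤ rk N (insert a' S) := rk_mono' (subset_insert _ _)
      constructor
      · rintro ⟨⟨hp, hrk⟩, ha'S⟩
        exact ⟨⟨hp, ha'S⟩, by omega⟩
      · rintro ⟨⟨hp, ha'S⟩, hrk⟩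
        exact ⟨⟨hp, by omega⟩, ha'S⟩
    omega
  omega

end TwelveCaptureD

end PercRepro.Cogirth
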